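/-
Origin: expansion seat `prover-pub-hodgecm-mc-binder-1-g16-0`, handover #R106 2026-08-20T20:01:13Z md5 bf1d58b37aa1 (281 l.; NEW additive universe-free leaf; imports #R105 HodgeCM.Model.LocalMinkowski only; install after #R105; drops ⇒ {#R108}; NAME LIST: HodgeCM.Level.conjK · HodgeCM.Level.mem_conjK_iff · HodgeCM.Level.conjK_one · HodgeCM.Level.conjK_mul · HodgeCM.Level.conjK_of_mem · HodgeCM.Level.conjK_mono · HodgeCM.Level.coe_conjK · HodgeCM.Level.isCompact_conjK · HodgeCM.Level.isOpen_conjK · HodgeCM.Level.Kthree · HodgeCM.Level.Kthree_eq · HodgeCM.Level.torsionFree_arithmeticLevel_conj_three · HodgeCM.Level.torsionFree_arithmeticLevel_of_le_conj_three · HodgeCM.Level.BelowConjThree · HodgeCM.Level.BelowConjThree.three · HodgeCM.Level.BelowConjThree.of_le · HodgeCM.Level.belowConjThree_of_le_three · HodgeCM.Level.BelowConjThree.conjK · HodgeCM.Level.conj · HodgeCM.Level.K_conj · HodgeCM.Level.Γ_conj · HodgeCM.Level.mem_conj_Γ_iff · HodgeCM.Level.BelowConjThree.conj · HodgeCM.Level.conj_one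 · HodgeCM.Level.conj_of_mem · HodgeCM.Level.conj_mul · HodgeCM.Level.conj_mul_of_mem · HodgeCM.Level.conj_mono · HodgeCM.Level.conj_congr · HodgeCM.Level.mem_Γ_iff · HodgeCM.Level.Γ_conj_rationalToFinAdelic) (`HOME/mc/pub-hodgecm-mc-binder-1-g16/stage62/HodgeCM/Model/LevelConjugate.lean`, md5 bf1d58b37aa1, 281 lines);
landed by the second packager p2 gen 13 (p2-g13) in gate run 62 as `HodgeCM/Model/LevelConjugate.lean` (verbatim).
-/
/-
Copyright (c) 2026 the pub-hodgecm formalisation cell (harness21).  New file, not vendored.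
Origin: session prover-pub-hodgecm-mc-binder-1-g16-0 (unit pub-hodgecm-mc-binder-1-g16, BINDER PROVER gen 16 of lineage mc-binder-1;
content lane (J-Liu-Θ), (J3) design memo `HOME/mc/pub-hodgecm-mc-axioms-1-g15/J3-DESIGN.md` §3, HECKE-TOWER sub-leaf (T0)
«conjugate levels `Γ_h = (U(L₀) ∩ hKh⁻¹, hKh⁻¹)`»), 2026-08-20.
-/
import Summits.HodgeConjecture.HodgeCM.Model.LocalMinkowski

/-!
# Conjugate levels `Γ_h = (U(V)(L₀) ∩ hKh⁻¹, hKh⁻¹)` of a Picard modular level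

For the tower carrier of the (J3) real-carrier dictionary (the `ℂ[U(V)(𝔸_{L₀,f})]`-module
`colim_K H¹(X_K(ℂ);ℂ)`, `X_K(ℂ) = ⊔_{[h] ∈ G(L₀)\G(𝔸_f)/K} Γ_h \ 𝔹`) every component `Γ_h \ 𝔹` must be a
surface of the universe, i.e. `Γ_h := (U(V)(L₀) ∩ hKh⁻¹, hKh⁻¹)` must be a `HodgeCM.Level V`
(`HodgeCM/CM/Basic.lean`): the compact open `hKh⁻¹ ≤ U(V)(𝔸_{L₀,f})` TOGETHER WITH the torsion-freeness of its
arithmetic group.  Compactness and openness are transported along the homeomorphism `x ↦ hxh⁻¹`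
(`isCompact_conjK`, `isOpen_conjK`); torsion-freeness is NOT automatic (it is not a property of the
commensurability class) and `hK_f(3)h⁻¹ ⊄ K_f(3)` in general, so the right hypothesis on `Γ` is

* `Level.BelowConjThree Γ : ∃ h₀, Γ.K ≤ h₀ K_f(3) h₀⁻¹` — satisfied by `Level.three V` and every level below
  it (`belowConjThree_of_le_three`), and STABLE under conjugation and under `≤`
  (`BelowConjThree.conj`, `BelowConjThree.of_le`),

under which `U(V)(L₀) ∩ hKh⁻¹` is torsion-free by the local Minkowski lemma of `Model/LocalMinkowski` applied
at one place `w ∣ 3` to `k_w = h_w⁻¹ γ_w h_w` (`torsionFree_arithmeticLevel_conj_three`: for EVERY finite-adelic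
`h`, with no class-number or lattice input).

Main definitions / results:

* `Level.conjK K h = hKh⁻¹`, with `conjK_one/mul/of_mem/mono`, `isCompact_conjK`, `isOpen_conjK`;
* `Level.torsionFree_arithmeticLevel_conj_three`, `Level.torsionFree_arithmeticLevel_of_le_conj_three`;
* `Level.conj Γ h hΓ : Level V` — THE CONJUGATE LEVEL, `K_conj`/`Γ_conj` (`rfl`), `mem_conj_Γ_iff`,
  `conj_one`, `conj_of_mem` (`Γ_{hk} = Γ_h`-invariance: `conj_mul_of_mem`), `conj_mul` (`Γ_{hh'} = (Γ_{h'})_h`),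
  `conj_mono`, and `Γ_conj_rationalToFinAdelic`: for a RATIONAL `g ∈ U(V)(L₀)` the arithmetic group of
  `Γ_{(g)_f}` is the honest conjugate `g Γ g⁻¹ ≤ GL₃(L)` (the `ConjInto` situation of `Model/LevelCoveringTwist`).
-/

noncomputable section

open scoped Matrix MatrixGroups
open NumberField IsDedekindDomain
open Literature.NumberTheory.Automorphic

namespace HodgeCM

namespace Level

open Model.LocalMinkowski

variable {L : CMField} {ι₁ : L →+* ℂ} {V : HermSpace3 L ι₁}

/-- The compact open `h K h⁻¹` (image of `K` under the inner automorphism `conj h` of `U(V)(𝔸_{L₀,f})`). -/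
abbrev conjK (K : Subgroup V.adelicFin) (h : V.adelicFin) : Subgroup V.adelicFin :=
  K.map (MulAut.conj h).toMonoidHom

/-- (Ported verbatim from the HodgeCMPerL package; no docstring in the source.) -/
theorem mem_conjK_iff {K : Subgroup V.adelicFin} {h x : V.adelicFin} :
    x ∈ conjK K h ↔ ∃ k ∈ K, h * k * h⁻¹ = x := by
  simp only [conjK, Subgroup.mem_map, MulEquiv.coe_toMonoidHom, MulAut.conj_apply]

/-- (Ported verbatim from the HodgeCMPerL package; no docstring in the source.) -/
theorem conjK_one (K : Subgroup V.adelicFin) : conjK K 1 = K := by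
  ext x
  rw [mem_conjK_iff]
  constructor
  · rintro ⟨k, hk, rfl⟩; simpa using hk
  · intro hx; exact ⟨x, hx, by simp⟩

/-- (Ported verbatim from the HodgeCMPerL package; no docstring in the source.) -/
theorem conjK_mul (K : Subgroup V.adelicFin) (h h' : V.adelicFin) : conjK K (h * h') = conjK (conjK K h') h := by
  ext x
  simp only [mem_conjK_iff]
  constructor
  · rintro ⟨k, hk, rfl⟩
    exact ⟨h' * k * h'⁻¹, ⟨k, hk, rfl⟩, by group⟩
  · rintro ⟨_, ⟨k, hk, rfl⟩, rfl⟩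
    exact ⟨k, hk, by group⟩

/-- (Ported verbatim from the HodgeCMPerL package; no docstring in the source.) -/
theorem conjK_of_mem {K : Subgroup V.adelicFin} {k : V.adelicFin} (hk : k ∈ K) : conjK K k = K := by
  ext x
  simp only [mem_conjK_iff]
  constructor
  · rintro ⟨k', hk', rfl⟩
    exact K.mul_mem (K.mul_mem hk hk') (K.inv_mem hk)
  · intro hx
    exact ⟨k⁻¹ * x * k, K.mul_mem (K.mul_mem (K.inv_mem hk) hx) hk, by group⟩

/-- (Ported verbatim from the HodgeCMPerL package; no docstring in the source.) -/
theorem conjK_mono {K K' : Subgroup V.adelicFin} (hKK' : K ≤ K') (h : V.adelicFin) : conjK K h ≤ conjK K' h :=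
  Subgroup.map_mono hKK'

/-- (Ported verbatim from the HodgeCMPerL package; no docstring in the source.) -/
theorem coe_conjK (K : Subgroup V.adelicFin) (h : V.adelicFin) :
    (conjK K h : Set V.adelicFin) = (fun x => h * x * h⁻¹) '' (K : Set V.adelicFin) := by
  ext x
  rw [SetLike.mem_coe, mem_conjK_iff, Set.mem_image]
  simp only [SetLike.mem_coe]

/-- (Ported verbatim from the HodgeCMPerL package; no docstring in the source.) -/
theorem isCompact_conjK {K : Subgroup V.adelicFin} (hK : IsCompact (K : Set V.adelicFin)) (h : V.adelicFin) :
    IsCompact (conjK K h : Set V.adelicFin) := by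
  rw [coe_conjK]
  exact hK.image ((continuous_const.mul continuous_id).mul continuous_const)

/-- (Ported verbatim from the HodgeCMPerL package; no docstring in the source.) -/
theorem isOpen_conjK {K : Subgroup V.adelicFin} (hK : IsOpen (K : Set V.adelicFin)) (h : V.adelicFin) :
    IsOpen (conjK K h : Set V.adelicFin) := by
  rw [coe_conjK]
  have hφ : (fun x : V.adelicFin => h * x * h⁻¹) = (Homeomorph.mulLeft h).trans (Homeomorph.mulRight h⁻¹) := by
    funext x; simp [Homeomorph.mulLeft, Homeomorph.mulRight]
  rw [hφ]
  exact ((Homeomorph.mulLeft h).trans (Homeomorph.mulRight h⁻¹)).isOpenMap _ hK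

/-- The principal compact open of level `3`: `K_f(3) = (Level.three V).K`. -/
abbrev Kthree (V : HermSpace3 L ι₁) : Subgroup V.adelicFin := (Level.three V).K

/-- (Ported verbatim from the HodgeCMPerL package; no docstring in the source.) -/
theorem Kthree_eq (V : HermSpace3 L ι₁) : Kthree V =
    UnitaryGroup.finCongruenceLevel (↥(maximalRealSubfield L)) (L : Type) (IsCMField.complexConj L) 3 V.Hm
      (Ideal.span {((3 : ℕ) : 𝓞 L)}) := rfl

/-- **`U(V)(L₀) ∩ h K_f(3) h⁻¹` is torsion-free for every finite-adelic `h`** (local Minkowski at a place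
`w ∣ 3`: `k_w = h_w⁻¹ γ_w h_w ≡ 1 mod 3𝒪_w` has finite order, hence is `1`). -/
theorem torsionFree_arithmeticLevel_conj_three (h : V.adelicFin) :
    ∀ γ ∈ UnitaryGroup.arithmeticLevel (↥(maximalRealSubfield L)) L (IsCMField.complexConj L) 3 V.Hm
      (conjK (Kthree V) h), IsOfFinOrder γ → γ = 1 := by
  intro γ hγ hfin
  obtain ⟨hγU, hγK⟩ := UnitaryGroup.mem_arithmeticLevel_iff.mp hγ
  obtain ⟨k, hk, hk'⟩ := mem_conjK_iff.mp hγK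
  obtain ⟨w, hw⟩ := exists_place_three_mem (L : Type)
  -- local components at `w`
  set Ev := GLn.evalAt 3 (L : Type) w with hEv
  set γw := Matrix.GeneralLinearGroup.map (algebraMap (L : Type) (w.adicCompletion L)) γ with hγw
  have hγw' : Ev ((UnitaryGroup.rationalToFinAdelic (↥(maximalRealSubfield L)) L (IsCMField.complexConj L) 3
      V.Hm ⟨γ, hγU⟩ : V.adelicFin) : GL (Fin 3) (FiniteAdeleRing (𝓞 L) L)) = γw :=
    UnitaryGroup.evalAt_rationalToFinAdelic _ _ _ _ w ⟨γ, hγU⟩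
  have hkw : Ev (k : GL (Fin 3) (FiniteAdeleRing (𝓞 L) L)) ∈
      valuedCongruenceSubgroup (Fin 3) (Valued.v (3 : w.adicCompletion L)) := by
    rw [← idealRadius_span_three w]
    exact (UnitaryGroup.mem_finCongruenceLevel_iff_forall _ _ _ _ _ _ k).mp hk w
  -- `k_w = h_w⁻¹ γ_w h_w`
  have hconj : Ev (k : GL (Fin 3) (FiniteAdeleRing (𝓞 L) L)) =
      (Ev (h : GL (Fin 3) (FiniteAdeleRing (𝓞 L) L)))⁻¹ * γw * Ev (h : GL (Fin 3) (FiniteAdeleRing (𝓞 L) L)) := by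
    have hval : ((h * k * h⁻¹ : V.adelicFin) : GL (Fin 3) (FiniteAdeleRing (𝓞 L) L)) =
        (h : GL (Fin 3) _) * (k : GL (Fin 3) _) * (h : GL (Fin 3) _)⁻¹ := by
      simp only [Subgroup.coe_mul, Subgroup.coe_inv]
    rw [← hγw', ← hk', hval, map_mul, map_mul, map_inv]
    group
  have hfinw : IsOfFinOrder (Ev (k : GL (Fin 3) (FiniteAdeleRing (𝓞 L) L))) := by
    rw [hconj]
    have hγfin : IsOfFinOrder γw := (Matrix.GeneralLinearGroup.map _).isOfFinOrder hfin
    simpa only [MulEquiv.coe_toMonoidHom, MulAut.conj_apply, inv_inv] using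
      (MulAut.conj (Ev (h : GL (Fin 3) (FiniteAdeleRing (𝓞 L) L)))⁻¹).toMonoidHom.isOfFinOrder hγfin
  haveI : CharZero (w.adicCompletion L) :=
    charZero_of_injective_algebraMap (algebraMap (L : Type) (w.adicCompletion L)).injective
  have hk1 : Ev (k : GL (Fin 3) (FiniteAdeleRing (𝓞 L) L)) = 1 :=
    eq_one_of_mem_valuedCongruenceSubgroup_three (valued_three_lt_one hw) _ hkw hfinw
  have hγw1 : γw = 1 := by
    have : γw = Ev (h : GL (Fin 3) (FiniteAdeleRing (𝓞 L) L)) * Ev (k : GL (Fin 3) (FiniteAdeleRing (𝓞 L) L)) *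
        (Ev (h : GL (Fin 3) (FiniteAdeleRing (𝓞 L) L)))⁻¹ := by
      rw [hconj]; group
    rw [this, hk1, mul_one, mul_inv_cancel]
  apply generalLinearGroup_map_adicCompletion_injective w
  rw [← hγw, hγw1, map_one]

/-- **Torsion-freeness below a conjugate of `K_f(3)`.** -/
theorem torsionFree_arithmeticLevel_of_le_conj_three {K : Subgroup V.adelicFin} {h₀ : V.adelicFin}
    (hK : K ≤ conjK (Kthree V) h₀) :
    ∀ γ ∈ UnitaryGroup.arithmeticLevel (↥(maximalRealSubfield L)) L (IsCMField.complexConj L) 3 V.Hm K,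
      IsOfFinOrder γ → γ = 1 := fun γ hγ hfin =>
  torsionFree_arithmeticLevel_conj_three h₀ γ (UnitaryGroup.arithmeticLevel_mono hK hγ) hfin

/-- `Γ` lies below a conjugate of the principal level `3`: `∃ h₀, Γ.K ≤ h₀ K_f(3) h₀⁻¹`.  This — and not
`Γ ≤ Level.three V` — is the hypothesis stable under conjugation AND under `≤`. -/
def BelowConjThree (Γ : Level V) : Prop := ∃ h₀ : V.adelicFin, Γ.K ≤ conjK (Kthree V) h₀

/-- (Ported verbatim from the HodgeCMPerL package; no docstring in the source.) -/
theorem BelowConjThree.three : (Level.three V).BelowConjThree := ⟨1, (conjK_one _).symm.le⟩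

/-- (Ported verbatim from the HodgeCMPerL package; no docstring in the source.) -/
theorem BelowConjThree.of_le {Γ Γ' : Level V} (hΓ : Γ.BelowConjThree) (h : Γ' ≤ Γ) : Γ'.BelowConjThree := by
  obtain ⟨h₀, hh₀⟩ := hΓ
  exact ⟨h₀, (le_def.mp h).trans hh₀⟩

/-- (Ported verbatim from the HodgeCMPerL package; no docstring in the source.) -/
theorem belowConjThree_of_le_three {Γ : Level V} (h : Γ ≤ Level.three V) : Γ.BelowConjThree :=
  BelowConjThree.three.of_le h

/-- (Ported verbatim from the HodgeCMPerL package; no docstring in the source.) -/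
theorem BelowConjThree.conjK {Γ : Level V} (hΓ : Γ.BelowConjThree) (h : V.adelicFin) :
    ∃ h₀ : V.adelicFin, conjK Γ.K h ≤ conjK (Kthree V) h₀ := by
  obtain ⟨h₀, hh₀⟩ := hΓ
  refine ⟨h * h₀, ?_⟩
  rw [conjK_mul]
  exact conjK_mono hh₀ h

/-- **The conjugate level `Γ_h = (U(V)(L₀) ∩ hKh⁻¹, hKh⁻¹)`** of a level `Γ = (U(L₀) ∩ K, K)` below a conjugate
of `K_f(3)`, for a finite-adelic `h ∈ U(V)(𝔸_{L₀,f})`: the level of the component `[h]` of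
`X_K(ℂ) = U(V)(L₀)\(𝔹 × U(V)(𝔸_{L₀,f})/K)`. -/
def conj (Γ : Level V) (h : V.adelicFin) (hΓ : Γ.BelowConjThree) : Level V where
  Γ := UnitaryGroup.arithmeticLevel (↥(maximalRealSubfield L)) L (IsCMField.complexConj L) 3 V.Hm (conjK Γ.K h)
  K := conjK Γ.K h
  isCompact_K := isCompact_conjK Γ.isCompact_K h
  isOpen_K := isOpen_conjK Γ.isOpen_K h
  arithmeticLevel_K := rfl
  torsionFree := torsionFree_arithmeticLevel_of_le_conj_three (hΓ.conjK h).choose_spec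

/-- (Ported verbatim from the HodgeCMPerL package; no docstring in the source.) -/
@[simp] theorem K_conj (Γ : Level V) (h : V.adelicFin) (hΓ : Γ.BelowConjThree) : (Γ.conj h hΓ).K = conjK Γ.K h := rfl

/-- (Ported verbatim from the HodgeCMPerL package; no docstring in the source.) -/
theorem Γ_conj (Γ : Level V) (h : V.adelicFin) (hΓ : Γ.BelowConjThree) : (Γ.conj h hΓ).Γ =
    UnitaryGroup.arithmeticLevel (↥(maximalRealSubfield L)) L (IsCMField.complexConj L) 3 V.Hm (conjK Γ.K h) :=
  rfl

/-- Membership in `Γ_h`: `γ ∈ U(V)(L₀)` with `(γ)_f = h k h⁻¹` for some `k ∈ K`. -/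
theorem mem_conj_Γ_iff (Γ : Level V) (h : V.adelicFin) (hΓ : Γ.BelowConjThree) {γ : GL (Fin 3) L} :
    γ ∈ (Γ.conj h hΓ).Γ ↔ ∃ hγ : γ ∈ UnitaryGroup.rational (↥(maximalRealSubfield L)) L (IsCMField.complexConj L) 3 V.Hm,
      ∃ k ∈ Γ.K, h * k * h⁻¹ =
        UnitaryGroup.rationalToFinAdelic (↥(maximalRealSubfield L)) L (IsCMField.complexConj L) 3 V.Hm ⟨γ, hγ⟩ := by
  rw [Γ_conj, UnitaryGroup.mem_arithmeticLevel_iff]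
  simp only [mem_conjK_iff]

/-- (Ported verbatim from the HodgeCMPerL package; no docstring in the source.) -/
theorem BelowConjThree.conj {Γ : Level V} (hΓ : Γ.BelowConjThree) (h : V.adelicFin) :
    (Γ.conj h hΓ).BelowConjThree := hΓ.conjK h

/-- Conjugating by `1` does nothing. -/
@[simp] theorem conj_one (Γ : Level V) (hΓ : Γ.BelowConjThree) : Γ.conj 1 hΓ = Γ := Level.ext (conjK_one Γ.K)

/-- Conjugating by an element of `K` does nothing (the component `[hk] = [h]`). -/
theorem conj_of_mem (Γ : Level V) {k : V.adelicFin} (hk : k ∈ Γ.K) (hΓ : Γ.BelowConjThree) : Γ.conj k hΓ = Γ :=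
  Level.ext (conjK_of_mem hk)

/-- `Γ_{h h'} = (Γ_{h'})_h`. -/
theorem conj_mul (Γ : Level V) (h h' : V.adelicFin) (hΓ : Γ.BelowConjThree) :
    Γ.conj (h * h') hΓ = (Γ.conj h' hΓ).conj h (hΓ.conj h') := Level.ext (conjK_mul Γ.K h h')

/-- `Γ_{h k} = Γ_h` for `k ∈ K`. -/
theorem conj_mul_of_mem (Γ : Level V) (h : V.adelicFin) {k : V.adelicFin} (hk : k ∈ Γ.K) (hΓ : Γ.BelowConjThree) :
    Γ.conj (h * k) hΓ = Γ.conj h hΓ := by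
  rw [conj_mul]
  congr 1
  exact conj_of_mem Γ hk hΓ

/-- Conjugation is monotone for the `K`-order. -/
theorem conj_mono {Γ Γ' : Level V} (hle : Γ' ≤ Γ) (h : V.adelicFin) (hΓ : Γ.BelowConjThree) (hΓ' : Γ'.BelowConjThree) :
    Γ'.conj h hΓ' ≤ Γ.conj h hΓ := le_def.mpr (conjK_mono (le_def.mp hle) h)

/-- The conjugate level does not depend on the proof of `BelowConjThree`. -/
theorem conj_congr (Γ : Level V) (h : V.adelicFin) (hΓ hΓ' : Γ.BelowConjThree) : Γ.conj h hΓ = Γ.conj h hΓ' := rfl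

/-- Membership in `Γ.Γ` through the pair: `γ ∈ U(V)(L₀)` with `(γ)_f ∈ K`. -/
theorem mem_Γ_iff (Γ : Level V) {γ : GL (Fin 3) L} :
    γ ∈ Γ.Γ ↔ ∃ hγ : γ ∈ UnitaryGroup.rational (↥(maximalRealSubfield L)) L (IsCMField.complexConj L) 3 V.Hm,
      UnitaryGroup.rationalToFinAdelic (↥(maximalRealSubfield L)) L (IsCMField.complexConj L) 3 V.Hm ⟨γ, hγ⟩ ∈ Γ.K := by
  rw [← Γ.arithmeticLevel_K, UnitaryGroup.mem_arithmeticLevel_iff]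

/-- **Conjugating by a RATIONAL element**: for `g ∈ U(V)(L₀)` the arithmetic group of `Γ_{(g)_f}` is the honest
conjugate `g Γ g⁻¹ ≤ GL₃(L)` (the `ConjInto` situation of the rational Hecke translates,
`Model/LevelCoveringTwist`). -/
theorem Γ_conj_rationalToFinAdelic (Γ : Level V) (hΓ : Γ.BelowConjThree)
    (g : UnitaryGroup.rational (↥(maximalRealSubfield L)) L (IsCMField.complexConj L) 3 V.Hm) :
    (Γ.conj (UnitaryGroup.rationalToFinAdelic (↥(maximalRealSubfield L)) L (IsCMField.complexConj L) 3 V.Hm g) hΓ).Γ =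
      Γ.Γ.map (MulAut.conj (g : GL (Fin 3) L)).toMonoidHom := by
  ext γ
  rw [mem_conj_Γ_iff, Subgroup.mem_map]
  simp only [MulEquiv.coe_toMonoidHom, MulAut.conj_apply]
  constructor
  · rintro ⟨hγ, k, hk, hk'⟩
    have hδU : (g : GL (Fin 3) L)⁻¹ * γ * g ∈
        UnitaryGroup.rational (↥(maximalRealSubfield L)) L (IsCMField.complexConj L) 3 V.Hm :=
      Subgroup.mul_mem _ (Subgroup.mul_mem _ (Subgroup.inv_mem _ g.2) hγ) g.2
    refine ⟨(g : GL (Fin 3) L)⁻¹ * γ * g, ?_, by group⟩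
    rw [mem_Γ_iff]
    refine ⟨hδU, ?_⟩
    have hδ : (⟨(g : GL (Fin 3) L)⁻¹ * γ * g, hδU⟩ : UnitaryGroup.rational (↥(maximalRealSubfield L)) L
        (IsCMField.complexConj L) 3 V.Hm) = g⁻¹ * ⟨γ, hγ⟩ * g := rfl
    rw [hδ, map_mul, map_mul, map_inv, ← hk']
    simpa only [mul_assoc, inv_mul_cancel_left, inv_mul_cancel, mul_one] using hk
  · rintro ⟨δ, hδ, rfl⟩
    obtain ⟨hδU, hδK⟩ := (mem_Γ_iff Γ).mp hδ
    have hγU : (g : GL (Fin 3) L) * δ * (g : GL (Fin 3) L)⁻¹ ∈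
        UnitaryGroup.rational (↥(maximalRealSubfield L)) L (IsCMField.complexConj L) 3 V.Hm :=
      Subgroup.mul_mem _ (Subgroup.mul_mem _ g.2 hδU) (Subgroup.inv_mem _ g.2)
    refine ⟨hγU, UnitaryGroup.rationalToFinAdelic (↥(maximalRealSubfield L)) L (IsCMField.complexConj L) 3 V.Hm
      ⟨δ, hδU⟩, hδK, ?_⟩
    have hγ : (⟨(g : GL (Fin 3) L) * δ * (g : GL (Fin 3) L)⁻¹, hγU⟩ : UnitaryGroup.rational (↥(maximalRealSubfield L)) L
        (IsCMField.complexConj L) 3 V.Hm) = g * ⟨δ, hδU⟩ * g⁻¹ := rfl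
    rw [hγ, map_mul, map_mul, map_inv]

end Level

end HodgeCM

end
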